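import Summits.Ventures.Crystal3D.Theorems.StickyWulffConstantTextureLiminfBarlowSealing
import Summits.Ventures.Crystal3D.Theorems.StickyWulffConstantTextureLiminfBarlowSampleBonds
import Summits.Ventures.Crystal3D.Theorems.StickyWulffConstantNoReconstructionGainBlanketDissolution
import Summits.Ventures.Crystal3D.Theorems.StickyWulffConstantGenericWallFloorCredits
import HarnessLib

/-!
# The slot ledger of ONE clamped Barlow plate: payers and cross bonds against inner-face slots and the rim
# (lane T, the T-side port of lane G's walker ledger — inner-face bookkeeping; crux `TextureLiminf`, stmt-Ventures-19483)

HONEST FRAMING. Venture `Summits/Ventures/Crystal3D` (cell `crystal3d-full`), helper `--supports` the crux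
`TextureLiminf` (stmt-Ventures-19483) of `route-Ventures-StickyWulffConstant`, registered line `TexShadow` (v6.5; cf-p1
ROUTE.md §86(23) R / §86(26) U).  Rung credit only; F-C1 not moved.  NOT the wall law.

Lane G's walker ledger ends every certified walker at an UNSATURATED ball of the window `−R₀−2 ≤ y₂ ≤ h+R₀+2` and counts
`#walkers ≤ Σ_{y ∈ PAY} (12 − deg y)` (`…GenericWallFloorWalkerFamilyLedger`); in lane G's currency the payer sum is then
compared with `2·D(X)` and the face AREAS of the fcc samples (`…InteriorCreditLedger`, `affineSampleDeficit_upper`).  Lane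
T's cell inequality `BilayerWallAt` (`…TexShadowWallDefs`) is written in cross bonds, the filling's `contactDeficiency` and
the plates' `innerBonds` — no surface tension of a Barlow plate is named.  This file is the ONE-PLATE half of the
comparison in that currency (the cell is assembled in `…TextureLiminfBilayerWallBookkeeping`):

* `plate_ledger_core` — a plate `P ⊆ stacking L s σ` inside a unit-separated `X`, a «window» `W ⊆ P` and payers `Q ⊆ W`
  such that every vacant site of a window ball is «beyond» or outside the disc `ρ`:
  `Σ_{p ∈ Q} (12 − deg_X p) + cross(P, X ∖ P) ≤ Σ_{p ∈ P} #{sites q of p at distance 1, beyond q} + 12·#(rim of W)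
  + 12·#{balls of X ∖ P touching P ∖ W}` (slot identity `card_contacts_add_ncard_vacant` of `…BarlowSampleBonds`, kissing);
* `bottomPlate_ledger` / `topPlate_ledger` — the clamped plates `stacking ∩ {a ≤ z ≤ b} ∩ disc ρ` of the wall cell
  (`b − a ≥ 3`, `ρ ≥ 2`, nothing of `X` below `a` / above `b`): window = the inner two unit layers, beyond = past the inner
  face; the balls touching the deep part are RIM balls by Barlow sealing (`stacking_sealing_below/above`,
  `…TextureLiminfBarlowSealing`), and both rims have `O((b−a)ρ)` balls (`card_mul_le_of_separated_in_shell`):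
  `Σ_{Q} (12 − deg_X) + cross(P, X ∖ P) ≤ Σ_{p ∈ P} #{inner sites} + (1728 + 576(b − a + 1))·ρ`.
WHAT THIS IS NOT: not the stubs `stub_bilayerWallGeneric/Residual`; F-C1 not moved.
-/

noncomputable section

namespace Summit.Ventures.Crystal3D.Theorems

open Finset Summit.Ventures.Crystal3D
open Literature.MathematicalPhysics.StatisticalMechanics (IsHaggSeq contactDeficiency)
open Summit.Ventures.Crystal3D.Cruxes.TextureLiminf.TexShadow (E3 stacking)
open scoped InnerProductSpace

/-! ## One plate: the slot ledger with a window -/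

open scoped Classical in
/-- **The plate ledger (core).**  See the module docstring.  `deg_X p = #(X.filter (dist p · = 1))`. -/
theorem plate_ledger_core {σ : ℤ → ℤ} (hσ : IsHaggSeq σ) (L : E3 ≃ₗᵢ[ℝ] E3) (s : E3)
    (X P W Q : Finset E3) (beyond : E3 → Prop) (ρ : ℝ) (hρ : 1 ≤ ρ)
    (hX : ∀ p ∈ X, ∀ q ∈ X, p ≠ q → 1 ≤ dist p q) (hPX : P ⊆ X)
    (hPS : (↑P : Set E3) ⊆ stacking L s σ) (hWP : W ⊆ P) (hQW : Q ⊆ W)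
    (hwin : ∀ p ∈ W, ∀ q ∈ stacking L s σ, dist p q = 1 → q ∉ P → beyond q ∨ ρ ^ 2 < q 0 ^ 2 + q 1 ^ 2) :
    ∑ p ∈ Q, ((12 : ℝ) - ((X.filter fun q => dist p q = 1).card : ℝ)) +
      ((((P ×ˢ (X \ P)).filter fun pq => dist pq.1 pq.2 = 1).card : ℕ) : ℝ) ≤
      ∑ p ∈ P, (({q : E3 | q ∈ stacking L s σ ∧ dist p q = 1 ∧ beyond q}).ncard : ℝ) +
        12 * (((W.filter fun p => (ρ - 1) ^ 2 < p 0 ^ 2 + p 1 ^ 2).card : ℕ) : ℝ) +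
        12 * ((((X \ P).filter fun y => ∃ p ∈ P \ W, dist p y = 1).card : ℕ) : ℝ) := by
  set S := stacking L s σ with hSdef
  set vac : E3 → ℝ := fun p => (({q : E3 | q ∈ S ∧ dist p q = 1 ∧ q ∉ P}).ncard : ℝ) with hvac
  set cr : E3 → ℝ := fun p => ((((X \ P).filter fun q => dist p q = 1).card : ℕ) : ℝ) with hcr
  set inner : E3 → ℝ := fun p => (({q : E3 | q ∈ S ∧ dist p q = 1 ∧ beyond q}).ncard : ℝ) with hinner
  set latv : E3 → ℝ := fun p => (({q : E3 | q ∈ S ∧ dist p q = 1 ∧ ρ ^ 2 < q 0 ^ 2 + q 1 ^ 2}).ncard : ℝ) with hlatv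
  have hQP : Q ⊆ P := hQW.trans hWP
  -- kissing and the slot identity
  have hkiss : ∀ p, ((X.filter fun q => dist p q = 1).card : ℝ) ≤ 12 := fun p => by
    exact_mod_cast card_filter_dist_eq_one_le_twelve X hX p
  have h12 : ∀ p ∈ P, (((P.filter fun q => dist p q = 1).card : ℕ) : ℝ) + vac p = 12 := fun p hp => by
    have := card_contacts_add_ncard_vacant hσ hPS hp
    simp only [hvac]; exact_mod_cast this
  have hsplit : ∀ p, ((X.filter fun q => dist p q = 1).card : ℝ) =
      cr p + (((P.filter fun q => dist p q = 1).card : ℕ) : ℝ) := fun p => card_filter_dist_eq_sdiff_add X P hPX p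
  have hf : ∀ p ∈ P, (12 : ℝ) - ((X.filter fun q => dist p q = 1).card : ℝ) = vac p - cr p := fun p hp => by
    rw [hsplit p]; linarith [h12 p hp]
  have hcr_le : ∀ p ∈ P, cr p ≤ vac p := fun p hp => by linarith [hf p hp, hkiss p, hsplit p, h12 p hp]
  have hvac0 : ∀ p, 0 ≤ vac p := fun p => by rw [hvac]; positivity
  have hcr0 : ∀ p, 0 ≤ cr p := fun p => by rw [hcr]; positivity
  -- the cross count as the sum of `cr`
  have hcross : ((((P ×ˢ (X \ P)).filter fun pq => dist pq.1 pq.2 = 1).card : ℕ) : ℝ) = ∑ p ∈ P, cr p :=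
    card_filter_product_dist_eq_sum P (X \ P)
  -- Step 1/2: `Σ_Q (vac − cr) + Σ_P cr ≤ Σ_W vac + Σ_{P \ W} cr`
  have hstep2 : ∑ p ∈ Q, ((12 : ℝ) - ((X.filter fun q => dist p q = 1).card : ℝ)) + ∑ p ∈ P, cr p ≤
      ∑ p ∈ W, vac p + ∑ p ∈ P \ W, cr p := by
    rw [Finset.sum_congr rfl fun p hp => hf p (hQP hp)]
    rw [← Finset.sum_sdiff hWP, ← Finset.sum_sdiff hQW, ← Finset.sum_sdiff hQW (f := vac), Finset.sum_sub_distrib]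
    have h1 : ∑ p ∈ W \ Q, cr p ≤ ∑ p ∈ W \ Q, vac p :=
      Finset.sum_le_sum fun p hp => hcr_le p (hWP (Finset.mem_sdiff.1 hp).1)
    linarith
  -- Step 3: the window's vacant slots are inner slots or lateral slots
  have hfinT : ∀ p ∈ P, ({q : E3 | q ∈ S ∧ dist p q = 1}).Finite := fun p hp =>
    Summit.Ventures.Crystal3D.TentCertificate.finite_touching hσ (hPS hp)
  have hT12 : ∀ p ∈ P, ({q : E3 | q ∈ S ∧ dist p q = 1}).ncard = 12 := fun p hp =>
    ncard_touching_stacking_eq_twelve hσ (hPS hp)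
  have hvac_le : ∀ p ∈ W, vac p ≤ inner p + latv p := by
    intro p hp
    have hsub : {q : E3 | q ∈ S ∧ dist p q = 1 ∧ q ∉ P} ⊆
        {q : E3 | q ∈ S ∧ dist p q = 1 ∧ beyond q} ∪ {q : E3 | q ∈ S ∧ dist p q = 1 ∧ ρ ^ 2 < q 0 ^ 2 + q 1 ^ 2} := by
      rintro q ⟨hqS, hd, hqP⟩
      rcases hwin p hp q hqS hd hqP with h | h
      · exact Or.inl ⟨hqS, hd, h⟩
      · exact Or.inr ⟨hqS, hd, h⟩
    have hfinU : ({q : E3 | q ∈ S ∧ dist p q = 1 ∧ beyond q} ∪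
        {q : E3 | q ∈ S ∧ dist p q = 1 ∧ ρ ^ 2 < q 0 ^ 2 + q 1 ^ 2}).Finite :=
      ((hfinT p (hWP hp)).subset fun q hq => ⟨hq.1, hq.2.1⟩).union
        ((hfinT p (hWP hp)).subset fun q hq => ⟨hq.1, hq.2.1⟩)
    have h1 := Set.ncard_le_ncard hsub hfinU
    have h2 := Set.ncard_union_le {q : E3 | q ∈ S ∧ dist p q = 1 ∧ beyond q}
      {q : E3 | q ∈ S ∧ dist p q = 1 ∧ ρ ^ 2 < q 0 ^ 2 + q 1 ^ 2}
    simp only [hvac, hinner, hlatv]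
    exact_mod_cast h1.trans h2
  have hlatv12 : ∀ p ∈ P, latv p ≤ 12 := by
    intro p hp
    have h1 := Set.ncard_le_ncard (show {q : E3 | q ∈ S ∧ dist p q = 1 ∧ ρ ^ 2 < q 0 ^ 2 + q 1 ^ 2} ⊆
      {q : E3 | q ∈ S ∧ dist p q = 1} from fun q hq => ⟨hq.1, hq.2.1⟩) (hfinT p hp)
    rw [hT12 p hp] at h1
    simp only [hlatv]; exact_mod_cast h1
  have hlatv0 : ∀ p, ¬ ((ρ - 1) ^ 2 < p 0 ^ 2 + p 1 ^ 2) → latv p = 0 := by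
    intro p hp
    push Not at hp
    have hempty : {q : E3 | q ∈ S ∧ dist p q = 1 ∧ ρ ^ 2 < q 0 ^ 2 + q 1 ^ 2} = ∅ := by
      ext q
      simp only [Set.mem_setOf_eq, Set.mem_empty_iff_false, iff_false, not_and, not_lt]
      intro _ hd
      have := lateral_sq_le_of_dist_le_one (y := q) (q := p) (r := ρ - 1) (by linarith) hp
        (by rw [dist_comm]; exact hd.le)
      have e : ρ - 1 + 1 = ρ := by ring
      rwa [e] at this
    simp only [hlatv, hempty, Set.ncard_empty, Nat.cast_zero]
  have hstep3 : ∑ p ∈ W, vac p ≤ ∑ p ∈ P, inner p +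
      12 * (((W.filter fun p => (ρ - 1) ^ 2 < p 0 ^ 2 + p 1 ^ 2).card : ℕ) : ℝ) := by
    have h1 : ∑ p ∈ W, vac p ≤ ∑ p ∈ W, inner p + ∑ p ∈ W, latv p := by
      rw [← Finset.sum_add_distrib]; exact Finset.sum_le_sum hvac_le
    have h2 : ∑ p ∈ W, inner p ≤ ∑ p ∈ P, inner p :=
      Finset.sum_le_sum_of_subset_of_nonneg hWP fun p _ _ => by rw [hinner]; positivity
    have h3 : ∑ p ∈ W, latv p ≤ 12 * (((W.filter fun p => (ρ - 1) ^ 2 < p 0 ^ 2 + p 1 ^ 2).card : ℕ) : ℝ) := by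
      rw [← Finset.sum_filter_add_sum_filter_not W (fun p => (ρ - 1) ^ 2 < p 0 ^ 2 + p 1 ^ 2) latv]
      have ha : ∑ p ∈ W.filter (fun p => (ρ - 1) ^ 2 < p 0 ^ 2 + p 1 ^ 2), latv p ≤
          ∑ p ∈ W.filter (fun p => (ρ - 1) ^ 2 < p 0 ^ 2 + p 1 ^ 2), (12 : ℝ) :=
        Finset.sum_le_sum fun p hp => hlatv12 p (hWP (Finset.mem_filter.1 hp).1)
      have hb : ∑ p ∈ W.filter (fun p => ¬ ((ρ - 1) ^ 2 < p 0 ^ 2 + p 1 ^ 2)), latv p = 0 :=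
        Finset.sum_eq_zero fun p hp => hlatv0 p (Finset.mem_filter.1 hp).2
      rw [Finset.sum_const, nsmul_eq_mul] at ha
      rw [hb, add_zero, mul_comm]
      exact ha
    linarith
  -- Step 4: the deep cross contacts sit on the balls touching `P \ W`, at most twelve each
  have hstep4 : ∑ p ∈ P \ W, cr p ≤ 12 * ((((X \ P).filter fun y => ∃ p ∈ P \ W, dist p y = 1).card : ℕ) : ℝ) := by
    have h1 : ∑ p ∈ P \ W, cr p = ∑ y ∈ X \ P, ((((P \ W).filter fun q => dist y q = 1).card : ℕ) : ℝ) := by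
      rw [hcr]; exact sum_card_filter_dist_comm (P \ W) (X \ P)
    rw [h1, ← Finset.sum_filter_add_sum_filter_not (X \ P) (fun y => ∃ p ∈ P \ W, dist p y = 1)]
    have ha : ∑ y ∈ (X \ P).filter (fun y => ∃ p ∈ P \ W, dist p y = 1),
        ((((P \ W).filter fun q => dist y q = 1).card : ℕ) : ℝ) ≤
        ∑ y ∈ (X \ P).filter (fun y => ∃ p ∈ P \ W, dist p y = 1), (12 : ℝ) := by
      refine Finset.sum_le_sum fun y _ => ?_
      have hsub : (P \ W).filter (fun q => dist y q = 1) ⊆ X.filter (fun q => dist y q = 1) :=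
        Finset.filter_subset_filter _ (Finset.sdiff_subset.trans hPX)
      exact le_trans (by exact_mod_cast Finset.card_le_card hsub) (hkiss y)
    have hb : ∑ y ∈ (X \ P).filter (fun y => ¬ ∃ p ∈ P \ W, dist p y = 1),
        ((((P \ W).filter fun q => dist y q = 1).card : ℕ) : ℝ) = 0 := by
      refine Finset.sum_eq_zero fun y hy => ?_
      have hy' := (Finset.mem_filter.1 hy).2
      have : (P \ W).filter (fun q => dist y q = 1) = ∅ := by
        refine Finset.filter_eq_empty_iff.2 fun q hq hd => hy' ⟨q, hq, by rw [dist_comm]; exact hd⟩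
      rw [this, Finset.card_empty, Nat.cast_zero]
    rw [Finset.sum_const, nsmul_eq_mul] at ha
    rw [hb, add_zero, mul_comm]
    exact ha
  rw [hcross]
  linarith [hstep2, hstep3, hstep4]

/-! ## Rim counts -/

/-- From the shell inequality `#S·(π/6) ≤ K·(π(ρ₂+1)² − π(ρ₁−1)²)` to a plain bound. -/
theorem card_le_of_shell_bound {n : ℕ} {K A B : ℝ} (h : (n : ℝ) * (Real.pi / 6) ≤ K * (Real.pi * A - Real.pi * B)) :
    (n : ℝ) ≤ 6 * K * (A - B) := by
  have hπ := Real.pi_pos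
  have h' : (n : ℝ) * Real.pi ≤ 6 * K * (A - B) * Real.pi := by nlinarith
  exact le_of_mul_le_mul_right h' hπ

/-! ## The two clamped plates of the wall cell -/

open scoped Classical in
/-- **Bottom plate ledger.**  Complete plate `P = stacking ∩ {a ≤ z ≤ b} ∩ disc ρ` (`b − a ≥ 3`, `ρ ≥ 2`) inside a
unit-separated `X` with nothing below height `a`; payers `Q ⊆ P` in the inner two unit layers `z ≥ b − 2`.  Then
`Σ_{Q} (12 − deg_X) + cross(P, X ∖ P) ≤ Σ_{p ∈ P} #{sites q : |p − q| = 1, b < q₂} + (1728 + 576(b − a + 1))·ρ`. -/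
theorem bottomPlate_ledger {σ : ℤ → ℤ} (hσ : IsHaggSeq σ) (L : E3 ≃ₗᵢ[ℝ] E3) (s : E3)
    (a b ρ : ℝ) (hab : 3 ≤ b - a) (hρ : 2 ≤ ρ) (X P Q : Finset E3)
    (hX : ∀ p ∈ X, ∀ q ∈ X, p ≠ q → 1 ≤ dist p q) (hPX : P ⊆ X)
    (hP : ∀ p, p ∈ P ↔ (p ∈ stacking L s σ ∧ a ≤ p 2 ∧ p 2 ≤ b ∧ p 0 ^ 2 + p 1 ^ 2 ≤ ρ ^ 2))
    (hfloor : ∀ x ∈ X, a ≤ x 2) (hQP : Q ⊆ P) (hQ : ∀ p ∈ Q, b - 2 ≤ p 2) :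
    ∑ p ∈ Q, ((12 : ℝ) - ((X.filter fun q => dist p q = 1).card : ℝ)) +
      ((((P ×ˢ (X \ P)).filter fun pq => dist pq.1 pq.2 = 1).card : ℕ) : ℝ) ≤
      ∑ p ∈ P, (({q : E3 | q ∈ stacking L s σ ∧ dist p q = 1 ∧ b < q 2}).ncard : ℝ) +
        (1728 + 576 * (b - a + 1)) * ρ := by
  set W := P.filter fun p => b - 2 ≤ p 2 with hWdef
  have hWP : W ⊆ P := Finset.filter_subset _ _
  have hQW : Q ⊆ W := fun p hp => Finset.mem_filter.2 ⟨hQP hp, hQ p hp⟩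
  have hPS : (↑P : Set E3) ⊆ stacking L s σ := fun p hp => ((hP p).1 hp).1
  have hρ1 : (1 : ℝ) ≤ ρ := by linarith
  have hρ0 : (0 : ℝ) ≤ ρ := by linarith
  -- window balls: a vacant site is beyond the inner face or outside the disc
  have hwin : ∀ p ∈ W, ∀ q ∈ stacking L s σ, dist p q = 1 → q ∉ P → b < q 2 ∨ ρ ^ 2 < q 0 ^ 2 + q 1 ^ 2 := by
    intro p hp q hqS hd hqP
    obtain ⟨hpP, hpw⟩ := Finset.mem_filter.1 hp
    have h2 := sq_sub_apply_le_dist_sq q p 2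
    rw [dist_comm, hd, one_pow] at h2
    have hqa : a ≤ q 2 := by nlinarith [sq_nonneg (q 2 - p 2 + 1)]
    by_contra hc
    push Not at hc
    exact hqP ((hP q).2 ⟨hqS, hqa, hc.1, hc.2⟩)
  have hcore := plate_ledger_core hσ L s X P W Q (fun q => b < q 2) ρ hρ1 hX hPX hPS hWP hQW hwin
  -- rim of the window: `O(ρ)` balls
  have hrimW : (((W.filter fun p => (ρ - 1) ^ 2 < p 0 ^ 2 + p 1 ^ 2).card : ℕ) : ℝ) ≤ 144 * ρ := by
    have h := card_mul_le_of_separated_in_shell (W.filter fun p => (ρ - 1) ^ 2 < p 0 ^ 2 + p 1 ^ 2)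
      (fun p hp q hq hne => hX p (hPX (hWP (Finset.mem_filter.1 hp).1)) q (hPX (hWP (Finset.mem_filter.1 hq).1)) hne)
      (b - 2) b (ρ - 1) ρ (by linarith) (by linarith) (by linarith)
      (fun p hp => by
        obtain ⟨hpW, hrim⟩ := Finset.mem_filter.1 hp
        obtain ⟨hpP, hpw⟩ := Finset.mem_filter.1 hpW
        obtain ⟨-, -, hpb, hlat⟩ := (hP p).1 hpP
        exact ⟨hpw, hpb, hrim, hlat⟩)
    have := card_le_of_shell_bound h
    nlinarith
  -- the balls touching the deep part are rim balls (Barlow sealing below)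
  have hrimY : ((((X \ P).filter fun y => ∃ p ∈ P \ W, dist p y = 1).card : ℕ) : ℝ) ≤ 48 * (b - a + 1) * ρ := by
    have h := card_mul_le_of_separated_in_shell ((X \ P).filter fun y => ∃ p ∈ P \ W, dist p y = 1)
      (fun p hp q hq hne => hX p (Finset.sdiff_subset (Finset.mem_filter.1 hp).1)
        q (Finset.sdiff_subset (Finset.mem_filter.1 hq).1) hne)
      a (b - 1) (ρ - 1) (ρ + 1) (by linarith) (by linarith) (by linarith)
      (fun y hy => by
        obtain ⟨hyXP, p, hp, hd⟩ := Finset.mem_filter.1 hy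
        obtain ⟨hyX, hyP⟩ := Finset.mem_sdiff.1 hyXP
        obtain ⟨hpP, hpW⟩ := Finset.mem_sdiff.1 hp
        have hpdeep : p 2 < b - 2 := by
          by_contra hc; push Not at hc; exact hpW (Finset.mem_filter.2 ⟨hpP, hc⟩)
        obtain ⟨-, -, -, hplat⟩ := (hP p).1 hpP
        have h2 := sq_sub_apply_le_dist_sq y p 2
        rw [dist_comm, hd, one_pow] at h2
        have hyb : y 2 ≤ b - 1 := by nlinarith [sq_nonneg (y 2 - p 2 - 1)]
        have hylat : y 0 ^ 2 + y 1 ^ 2 ≤ (ρ + 1) ^ 2 :=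
          lateral_sq_le_of_dist_le_one hρ0 hplat (by rw [dist_comm]; exact hd.le)
        have hyrim : (ρ - 1) ^ 2 < y 0 ^ 2 + y 1 ^ 2 := by
          by_contra hc; push Not at hc
          exact stacking_sealing_below hσ L s a b ρ hρ1 X P hX hPX hP y hyX hyP (hfloor y hyX) hyb hc
        exact ⟨hfloor y hyX, hyb, hyrim, hylat⟩)
    have := card_le_of_shell_bound h
    nlinarith
  nlinarith [hcore, hrimW, hrimY]

open scoped Classical in
/-- **Top plate ledger.**  Mirror image: complete plate in `{a ≤ z ≤ b}`, nothing of `X` above height `b`, payers in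
the inner two unit layers `z ≤ a + 2`, inner sites `q₂ < a`. -/
theorem topPlate_ledger {σ : ℤ → ℤ} (hσ : IsHaggSeq σ) (L : E3 ≃ₗᵢ[ℝ] E3) (s : E3)
    (a b ρ : ℝ) (hab : 3 ≤ b - a) (hρ : 2 ≤ ρ) (X P Q : Finset E3)
    (hX : ∀ p ∈ X, ∀ q ∈ X, p ≠ q → 1 ≤ dist p q) (hPX : P ⊆ X)
    (hP : ∀ p, p ∈ P ↔ (p ∈ stacking L s σ ∧ a ≤ p 2 ∧ p 2 ≤ b ∧ p 0 ^ 2 + p 1 ^ 2 ≤ ρ ^ 2))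
    (hceil : ∀ x ∈ X, x 2 ≤ b) (hQP : Q ⊆ P) (hQ : ∀ p ∈ Q, p 2 ≤ a + 2) :
    ∑ p ∈ Q, ((12 : ℝ) - ((X.filter fun q => dist p q = 1).card : ℝ)) +
      ((((P ×ˢ (X \ P)).filter fun pq => dist pq.1 pq.2 = 1).card : ℕ) : ℝ) ≤
      ∑ p ∈ P, (({q : E3 | q ∈ stacking L s σ ∧ dist p q = 1 ∧ q 2 < a}).ncard : ℝ) +
        (1728 + 576 * (b - a + 1)) * ρ := by
  set W := P.filter fun p => p 2 ≤ a + 2 with hWdef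
  have hWP : W ⊆ P := Finset.filter_subset _ _
  have hQW : Q ⊆ W := fun p hp => Finset.mem_filter.2 ⟨hQP hp, hQ p hp⟩
  have hPS : (↑P : Set E3) ⊆ stacking L s σ := fun p hp => ((hP p).1 hp).1
  have hρ1 : (1 : ℝ) ≤ ρ := by linarith
  have hρ0 : (0 : ℝ) ≤ ρ := by linarith
  have hwin : ∀ p ∈ W, ∀ q ∈ stacking L s σ, dist p q = 1 → q ∉ P → q 2 < a ∨ ρ ^ 2 < q 0 ^ 2 + q 1 ^ 2 := by
    intro p hp q hqS hd hqP
    obtain ⟨hpP, hpw⟩ := Finset.mem_filter.1 hp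
    have h2 := sq_sub_apply_le_dist_sq q p 2
    rw [dist_comm, hd, one_pow] at h2
    have hqb : q 2 ≤ b := by nlinarith [sq_nonneg (q 2 - p 2 - 1)]
    by_contra hc
    push Not at hc
    exact hqP ((hP q).2 ⟨hqS, hc.1, hqb, hc.2⟩)
  have hcore := plate_ledger_core hσ L s X P W Q (fun q => q 2 < a) ρ hρ1 hX hPX hPS hWP hQW hwin
  have hrimW : (((W.filter fun p => (ρ - 1) ^ 2 < p 0 ^ 2 + p 1 ^ 2).card : ℕ) : ℝ) ≤ 144 * ρ := by
    have h := card_mul_le_of_separated_in_shell (W.filter fun p => (ρ - 1) ^ 2 < p 0 ^ 2 + p 1 ^ 2)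
      (fun p hp q hq hne => hX p (hPX (hWP (Finset.mem_filter.1 hp).1)) q (hPX (hWP (Finset.mem_filter.1 hq).1)) hne)
      a (a + 2) (ρ - 1) ρ (by linarith) (by linarith) (by linarith)
      (fun p hp => by
        obtain ⟨hpW, hrim⟩ := Finset.mem_filter.1 hp
        obtain ⟨hpP, hpw⟩ := Finset.mem_filter.1 hpW
        obtain ⟨-, hpa, -, hlat⟩ := (hP p).1 hpP
        exact ⟨hpa, hpw, hrim, hlat⟩)
    have := card_le_of_shell_bound h
    nlinarith
  have hrimY : ((((X \ P).filter fun y => ∃ p ∈ P \ W, dist p y = 1).card : ℕ) : ℝ) ≤ 48 * (b - a + 1) * ρ := by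
    have h := card_mul_le_of_separated_in_shell ((X \ P).filter fun y => ∃ p ∈ P \ W, dist p y = 1)
      (fun p hp q hq hne => hX p (Finset.sdiff_subset (Finset.mem_filter.1 hp).1)
        q (Finset.sdiff_subset (Finset.mem_filter.1 hq).1) hne)
      (a + 1) b (ρ - 1) (ρ + 1) (by linarith) (by linarith) (by linarith)
      (fun y hy => by
        obtain ⟨hyXP, p, hp, hd⟩ := Finset.mem_filter.1 hy
        obtain ⟨hyX, hyP⟩ := Finset.mem_sdiff.1 hyXP
        obtain ⟨hpP, hpW⟩ := Finset.mem_sdiff.1 hp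
        have hpdeep : a + 2 < p 2 := by
          by_contra hc; push Not at hc; exact hpW (Finset.mem_filter.2 ⟨hpP, hc⟩)
        obtain ⟨-, -, -, hplat⟩ := (hP p).1 hpP
        have h2 := sq_sub_apply_le_dist_sq y p 2
        rw [dist_comm, hd, one_pow] at h2
        have hya : a + 1 ≤ y 2 := by nlinarith [sq_nonneg (y 2 - p 2 + 1)]
        have hylat : y 0 ^ 2 + y 1 ^ 2 ≤ (ρ + 1) ^ 2 :=
          lateral_sq_le_of_dist_le_one hρ0 hplat (by rw [dist_comm]; exact hd.le)
        have hyrim : (ρ - 1) ^ 2 < y 0 ^ 2 + y 1 ^ 2 := by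
          by_contra hc; push Not at hc
          exact stacking_sealing_above hσ L s a b ρ hρ1 X P hX hPX hP y hyX hyP hya (hceil y hyX) hc
        exact ⟨hya, hceil y hyX, hyrim, hylat⟩)
    have := card_le_of_shell_bound h
    nlinarith
  nlinarith [hcore, hrimW, hrimY]

end Summit.Ventures.Crystal3D.Theorems

end
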